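import Summits.KontsevichZagierPeriods.KontsevichZagierPeriods.Theorems.HurwitzMicroSectorsNormalFormPrincipleM3KernelRefs
import Summits.KontsevichZagierPeriods.KontsevichZagierPeriods.Theorems.HurwitzMicroSectorsNormalFormPrincipleM3KernelReduceHalfPoint
import Summits.KontsevichZagierPeriods.KontsevichZagierPeriods.Theorems.HurwitzMicroSectorsNormalFormPrincipleM3KernelReduceZeta
import Summits.KontsevichZagierPeriods.KontsevichZagierPeriods.Theorems.HurwitzMicroSectorsNormalFormPrincipleM3KernelReduceLog
import Summits.KontsevichZagierPeriods.KontsevichZagierPeriods.Theorems.MzvKernelInKZ.Negative.ScalingDivision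

/-!
# `NormalFormPrinciple` (stmt-KontsevichZagierPeriods-3869), line `SketchIdeator1` —
# leaf `stub_boxRigidity` in DIMENSION THREE: the KERNEL CAPSTONE of the six `m3-equal-value-instances`

Assembly file (lead seat c9; `--supports` the crux). The six transcendence-free dimension-three
instances of the leaf typed by the strategist (crux idea `m3-equal-value-instances`) involve eleven
box-rational families on the open unit box `(0,1)³`:
`1/((1−xy)(1−xyz))`, `2/(1−xyz)`, `8/((1+xy)(1+xyz))`, `5/(1−xyz)`, `16/((2−x)(2−xyz))`,
`2/((2−xy)(2−xyz))`, `1/((1+x)(1+xyz))`, `4/((2−x)(1−xyz))`, `3/((1−xy)(1+z))`, and the two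
reference boxes `1/(1−xyz)` (value `ζ(3)`) and `1/((1−xy)(1+z))` (value `ζ(2)·log 2`). Their values
span `ℚζ(3) + ℚπ²log 2`. This file proves **Conjecture 1 of Kontsevich–Zagier on the subgroup of
`KZ.FormalRep` generated by all representations of these eleven families, conditionally on the
`ℚ`-linear independence of `ζ(3)` and `π²·log 2`** (open; implied by Schanuel-type conjectures):
every element of that subgroup with value zero is a relation of the calculus
(`m3Instances_mem_relations_of_eval_eq_zero`), hence any two of these representations with equal
values are KZ-equivalent (`m3Instances_equivalent_of_value_eq`) — the exact shape of the leaf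
`stub_boxRigidity`, one dimension up from seat c7's level-one tower, with the transcendence input
named and isolated.

Proof: every generator `N` reduces, after doubling, to `α[Z] + β[Q]` modulo `KZ.relations`
(`m3k_reduce_zeta`, `m3k_reduce_log`: the six landed move chains `eulerBoxDuality`,
`fiveEighthsZetaThree`, `halfPointZetaThree`, `halfPointDuality`, `halfPointZetaTwoLogTwo`,
`weightDropTornheim`'s siblings, plus the word-level certificate `m3k_reduce_halfPoint`:
`2[1/((1+x)(1+xyz))] ≡ 2[Z] − [Q]`); the reduction extends to the subgroup by closure induction;
evaluating (`relations ≤ ker eval`, `Z.value = ζ(3)`, `Q.value = π²log2/6` from `m3k_exists_refs`)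
and applying the independence hypothesis kills `α`, `β`; finally INTEGER DIVISION
(`MzvKernelInKZ.Negative.mem_relations_of_nsmul_mem`, a derived rule of the calculus) removes the
doubling. Sources: M. Kontsevich, D. Zagier, *Periods* (2001), §1.2 Conjecture 1.
No definitions are introduced.
-/

noncomputable section

open MeasureTheory Set
open Literature.NumberTheory.Transcendental Literature.NumberTheory.Transcendental.KZ
open Summit.KontsevichZagierPeriods.MzvKernelInKZ.Negative (mem_relations_of_nsmul_mem)

namespace Summit.KontsevichZagierPeriods.HurwitzMicroSectors.NormalFormPrinciple.PiBox.M3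


/-- **Kernel capstone of the dimension-three instances (registered sub-goal
`m3Instances_mem_relations_of_eval_eq_zero` of stmt-KontsevichZagierPeriods-3869, line `SketchIdeator1`).**
Assume `ζ(3)` and `π²·log 2` are `ℚ`-linearly independent. Then every `ℤ`-combination of
representations of the eleven dimension-three box families of the six `m3-equal-value-instances`
whose value vanishes is a relation of the Kontsevich–Zagier calculus.
[cite: KontsevichZagier2001, §1.2 Conjecture 1] -/
theorem m3Instances_mem_relations_of_eval_eq_zero
    (hind : LinearIndependent ℚ ![zetaValue 3, Real.pi ^ 2 * Real.log 2])
    {c : FormalRep}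
    (hc : c ∈ AddSubgroup.closure
      ({y : FormalRep | ∃ N : IntegralRep 3, N.domain = {x | ∀ i, x i ∈ Set.Ioo (0:ℝ) 1} ∧
        EqOn N.integrand (fun x => 1 / ((1 - x 0 * x 1) * (1 - x 0 * x 1 * x 2))) N.domain ∧ y = of N} ∪
      {y : FormalRep | ∃ N : IntegralRep 3, N.domain = {x | ∀ i, x i ∈ Set.Ioo (0:ℝ) 1} ∧
        EqOn N.integrand (fun x => 2 / (1 - x 0 * x 1 * x 2)) N.domain ∧ y = of N} ∪
      {y : FormalRep | ∃ N : IntegralRep 3, N.domain = {x | ∀ i, x i ∈ Set.Ioo (0:ℝ) 1} ∧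
        EqOn N.integrand (fun x => 8 / ((1 + x 0 * x 1) * (1 + x 0 * x 1 * x 2))) N.domain ∧ y = of N} ∪
      {y : FormalRep | ∃ N : IntegralRep 3, N.domain = {x | ∀ i, x i ∈ Set.Ioo (0:ℝ) 1} ∧
        EqOn N.integrand (fun x => 5 / (1 - x 0 * x 1 * x 2)) N.domain ∧ y = of N} ∪
      {y : FormalRep | ∃ N : IntegralRep 3, N.domain = {x | ∀ i, x i ∈ Set.Ioo (0:ℝ) 1} ∧
        EqOn N.integrand (fun x => 16 / ((2 - x 0) * (2 - x 0 * x 1 * x 2))) N.domain ∧ y = of N} ∪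
      {y : FormalRep | ∃ N : IntegralRep 3, N.domain = {x | ∀ i, x i ∈ Set.Ioo (0:ℝ) 1} ∧
        EqOn N.integrand (fun x => 2 / ((2 - x 0 * x 1) * (2 - x 0 * x 1 * x 2))) N.domain ∧ y = of N} ∪
      {y : FormalRep | ∃ N : IntegralRep 3, N.domain = {x | ∀ i, x i ∈ Set.Ioo (0:ℝ) 1} ∧
        EqOn N.integrand (fun x => 1 / ((1 + x 0) * (1 + x 0 * x 1 * x 2))) N.domain ∧ y = of N} ∪
      {y : FormalRep | ∃ N : IntegralRep 3, N.domain = {x | ∀ i, x i ∈ Set.Ioo (0:ℝ) 1} ∧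
        EqOn N.integrand (fun x => 4 / ((2 - x 0) * (1 - x 0 * x 1 * x 2))) N.domain ∧ y = of N} ∪
      {y : FormalRep | ∃ N : IntegralRep 3, N.domain = {x | ∀ i, x i ∈ Set.Ioo (0:ℝ) 1} ∧
        EqOn N.integrand (fun x => 3 / ((1 - x 0 * x 1) * (1 + x 2))) N.domain ∧ y = of N} ∪
      {y : FormalRep | ∃ N : IntegralRep 3, N.domain = {x | ∀ i, x i ∈ Set.Ioo (0:ℝ) 1} ∧
        EqOn N.integrand (fun x => 1 / (1 - x 0 * x 1 * x 2)) N.domain ∧ y = of N} ∪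
      {y : FormalRep | ∃ N : IntegralRep 3, N.domain = {x | ∀ i, x i ∈ Set.Ioo (0:ℝ) 1} ∧
        EqOn N.integrand (fun x => 1 / ((1 - x 0 * x 1) * (1 + x 2))) N.domain ∧ y = of N}))
    (hv : eval c = 0) : c ∈ relations := by
  obtain ⟨Z, Q, N7, ⟨hZd, hZi, hZv⟩, ⟨hQd, hQi, hQv⟩, ⟨hN7d, hN7i⟩⟩ := m3k_exists_refs
  obtain ⟨r10, r2, r4, r1, r3, r5⟩ := m3k_reduce_zeta Z Q N7 hZd hZi hQd hQi hN7d hN7i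
  obtain ⟨r11, r9, r8, r7, r6⟩ := m3k_reduce_log Z Q N7 hZd hZi hQd hQi hN7d hN7i
  -- every element of the subgroup reduces, after doubling, to `αZ + βQ`
  have hred : ∀ c ∈ AddSubgroup.closure
      ({y : FormalRep | ∃ N : IntegralRep 3, N.domain = {x | ∀ i, x i ∈ Set.Ioo (0:ℝ) 1} ∧
        EqOn N.integrand (fun x => 1 / ((1 - x 0 * x 1) * (1 - x 0 * x 1 * x 2))) N.domain ∧ y = of N} ∪
      {y : FormalRep | ∃ N : IntegralRep 3, N.domain = {x | ∀ i, x i ∈ Set.Ioo (0:ℝ) 1} ∧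
        EqOn N.integrand (fun x => 2 / (1 - x 0 * x 1 * x 2)) N.domain ∧ y = of N} ∪
      {y : FormalRep | ∃ N : IntegralRep 3, N.domain = {x | ∀ i, x i ∈ Set.Ioo (0:ℝ) 1} ∧
        EqOn N.integrand (fun x => 8 / ((1 + x 0 * x 1) * (1 + x 0 * x 1 * x 2))) N.domain ∧ y = of N} ∪
      {y : FormalRep | ∃ N : IntegralRep 3, N.domain = {x | ∀ i, x i ∈ Set.Ioo (0:ℝ) 1} ∧
        EqOn N.integrand (fun x => 5 / (1 - x 0 * x 1 * x 2)) N.domain ∧ y = of N} ∪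
      {y : FormalRep | ∃ N : IntegralRep 3, N.domain = {x | ∀ i, x i ∈ Set.Ioo (0:ℝ) 1} ∧
        EqOn N.integrand (fun x => 16 / ((2 - x 0) * (2 - x 0 * x 1 * x 2))) N.domain ∧ y = of N} ∪
      {y : FormalRep | ∃ N : IntegralRep 3, N.domain = {x | ∀ i, x i ∈ Set.Ioo (0:ℝ) 1} ∧
        EqOn N.integrand (fun x => 2 / ((2 - x 0 * x 1) * (2 - x 0 * x 1 * x 2))) N.domain ∧ y = of N} ∪
      {y : FormalRep | ∃ N : IntegralRep 3, N.domain = {x | ∀ i, x i ∈ Set.Ioo (0:ℝ) 1} ∧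
        EqOn N.integrand (fun x => 1 / ((1 + x 0) * (1 + x 0 * x 1 * x 2))) N.domain ∧ y = of N} ∪
      {y : FormalRep | ∃ N : IntegralRep 3, N.domain = {x | ∀ i, x i ∈ Set.Ioo (0:ℝ) 1} ∧
        EqOn N.integrand (fun x => 4 / ((2 - x 0) * (1 - x 0 * x 1 * x 2))) N.domain ∧ y = of N} ∪
      {y : FormalRep | ∃ N : IntegralRep 3, N.domain = {x | ∀ i, x i ∈ Set.Ioo (0:ℝ) 1} ∧
        EqOn N.integrand (fun x => 3 / ((1 - x 0 * x 1) * (1 + x 2))) N.domain ∧ y = of N} ∪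
      {y : FormalRep | ∃ N : IntegralRep 3, N.domain = {x | ∀ i, x i ∈ Set.Ioo (0:ℝ) 1} ∧
        EqOn N.integrand (fun x => 1 / (1 - x 0 * x 1 * x 2)) N.domain ∧ y = of N} ∪
      {y : FormalRep | ∃ N : IntegralRep 3, N.domain = {x | ∀ i, x i ∈ Set.Ioo (0:ℝ) 1} ∧
        EqOn N.integrand (fun x => 1 / ((1 - x 0 * x 1) * (1 + x 2))) N.domain ∧ y = of N}), ∃ α β : ℤ, (2:ℕ) • c - (α • of Z + β • of Q) ∈ relations := by
    intro c hc
    induction hc using AddSubgroup.closure_induction with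
    | mem y hy =>
      simp only [mem_union, mem_setOf_eq] at hy
      rcases hy with ((((((((((⟨N, hNd, hNi, rfl⟩ | ⟨N, hNd, hNi, rfl⟩) | ⟨N, hNd, hNi, rfl⟩) |
        ⟨N, hNd, hNi, rfl⟩) | ⟨N, hNd, hNi, rfl⟩) | ⟨N, hNd, hNi, rfl⟩) | ⟨N, hNd, hNi, rfl⟩) |
        ⟨N, hNd, hNi, rfl⟩) | ⟨N, hNd, hNi, rfl⟩) | ⟨N, hNd, hNi, rfl⟩) | ⟨N, hNd, hNi, rfl⟩)
      · exact ⟨4, 0, r1 N hNd hNi⟩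
      · exact ⟨4, 0, r2 N hNd hNi⟩
      · exact ⟨10, 0, r3 N hNd hNi⟩
      · exact ⟨10, 0, r4 N hNd hNi⟩
      · exact ⟨10, 0, r5 N hNd hNi⟩
      · exact ⟨2, -1, r6 N hNd hNi⟩
      · exact ⟨2, -1, r7 N hNd hNi⟩
      · exact ⟨0, 6, r8 N hNd hNi⟩
      · exact ⟨0, 6, r9 N hNd hNi⟩
      · exact ⟨2, 0, r10 N hNd hNi⟩
      · exact ⟨0, 2, r11 N hNd hNi⟩
    | zero =>
      refine ⟨0, 0, ?_⟩
      simp only [smul_zero, zero_smul, add_zero, sub_zero]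
      exact relations.zero_mem
    | add y z _ _ ihy ihz =>
      obtain ⟨α₁, β₁, h₁⟩ := ihy
      obtain ⟨α₂, β₂, h₂⟩ := ihz
      refine ⟨α₁ + α₂, β₁ + β₂, ?_⟩
      have e : (2:ℕ) • (y + z) - ((α₁ + α₂) • of Z + (β₁ + β₂) • of Q) =
          ((2:ℕ) • y - (α₁ • of Z + β₁ • of Q)) + ((2:ℕ) • z - (α₂ • of Z + β₂ • of Q)) := by
        simp only [smul_add, add_smul]; abel
      rw [e]
      exact relations.add_mem h₁ h₂
    | neg y _ ih =>
      obtain ⟨α, β, h⟩ := ih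
      refine ⟨-α, -β, ?_⟩
      have e : (2:ℕ) • (-y) - ((-α) • of Z + (-β) • of Q) = -((2:ℕ) • y - (α • of Z + β • of Q)) := by
        simp only [smul_neg, neg_smul]; abel
      rw [e]
      exact relations.neg_mem h
  obtain ⟨α, β, h⟩ := hred c hc
  -- evaluate: `0 = α ζ(3) + β π² log 2 / 6`
  have hev := relations_le_ker_eval_holds h
  rw [AddMonoidHom.mem_ker, map_sub, map_nsmul, map_add, map_zsmul, map_zsmul, eval_of, eval_of,
    hv, hZv, hQv, smul_zero, zero_sub, neg_eq_zero] at hev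
  have hαβ : α = 0 ∧ β = 0 := by
    rw [Fintype.linearIndependent_iff] at hind
    have key := hind ![(α : ℚ), (β : ℚ) / 6] (by
      rw [Fin.sum_univ_two]
      simp only [Matrix.cons_val_zero, Matrix.cons_val_one, Rat.smul_def]
      push_cast
      rw [zsmul_eq_mul, zsmul_eq_mul] at hev
      linarith)
    have h0 := key 0
    have h1 := key 1
    simp only [Matrix.cons_val_zero, Matrix.cons_val_one] at h0 h1
    exact ⟨by exact_mod_cast h0, by
      have : (β : ℚ) = 0 := by linarith
      exact_mod_cast this⟩
  obtain ⟨rfl, rfl⟩ := hαβ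
  simp only [zero_smul, add_zero, sub_zero] at h
  exact mem_relations_of_nsmul_mem (by norm_num) h

/-- **Conjecture 1 (the leaf `stub_boxRigidity`) on the eleven dimension-three box families of the
six instances, conditionally on `LinearIndependent ℚ ![ζ(3), π²·log 2]`**: two representations taken
from these families with equal values are KZ-equivalent. [cite: KontsevichZagier2001, §1.2 Conjecture 1] -/
theorem m3Instances_equivalent_of_value_eq
    (hind : LinearIndependent ℚ ![zetaValue 3, Real.pi ^ 2 * Real.log 2])
    {N N' : IntegralRep 3}
    (hN : of N ∈ {y : FormalRep | ∃ N : IntegralRep 3, N.domain = {x | ∀ i, x i ∈ Set.Ioo (0:ℝ) 1} ∧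
        EqOn N.integrand (fun x => 1 / ((1 - x 0 * x 1) * (1 - x 0 * x 1 * x 2))) N.domain ∧ y = of N} ∪
      {y : FormalRep | ∃ N : IntegralRep 3, N.domain = {x | ∀ i, x i ∈ Set.Ioo (0:ℝ) 1} ∧
        EqOn N.integrand (fun x => 2 / (1 - x 0 * x 1 * x 2)) N.domain ∧ y = of N} ∪
      {y : FormalRep | ∃ N : IntegralRep 3, N.domain = {x | ∀ i, x i ∈ Set.Ioo (0:ℝ) 1} ∧
        EqOn N.integrand (fun x => 8 / ((1 + x 0 * x 1) * (1 + x 0 * x 1 * x 2))) N.domain ∧ y = of N} ∪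
      {y : FormalRep | ∃ N : IntegralRep 3, N.domain = {x | ∀ i, x i ∈ Set.Ioo (0:ℝ) 1} ∧
        EqOn N.integrand (fun x => 5 / (1 - x 0 * x 1 * x 2)) N.domain ∧ y = of N} ∪
      {y : FormalRep | ∃ N : IntegralRep 3, N.domain = {x | ∀ i, x i ∈ Set.Ioo (0:ℝ) 1} ∧
        EqOn N.integrand (fun x => 16 / ((2 - x 0) * (2 - x 0 * x 1 * x 2))) N.domain ∧ y = of N} ∪
      {y : FormalRep | ∃ N : IntegralRep 3, N.domain = {x | ∀ i, x i ∈ Set.Ioo (0:ℝ) 1} ∧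
        EqOn N.integrand (fun x => 2 / ((2 - x 0 * x 1) * (2 - x 0 * x 1 * x 2))) N.domain ∧ y = of N} ∪
      {y : FormalRep | ∃ N : IntegralRep 3, N.domain = {x | ∀ i, x i ∈ Set.Ioo (0:ℝ) 1} ∧
        EqOn N.integrand (fun x => 1 / ((1 + x 0) * (1 + x 0 * x 1 * x 2))) N.domain ∧ y = of N} ∪
      {y : FormalRep | ∃ N : IntegralRep 3, N.domain = {x | ∀ i, x i ∈ Set.Ioo (0:ℝ) 1} ∧
        EqOn N.integrand (fun x => 4 / ((2 - x 0) * (1 - x 0 * x 1 * x 2))) N.domain ∧ y = of N} ∪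
      {y : FormalRep | ∃ N : IntegralRep 3, N.domain = {x | ∀ i, x i ∈ Set.Ioo (0:ℝ) 1} ∧
        EqOn N.integrand (fun x => 3 / ((1 - x 0 * x 1) * (1 + x 2))) N.domain ∧ y = of N} ∪
      {y : FormalRep | ∃ N : IntegralRep 3, N.domain = {x | ∀ i, x i ∈ Set.Ioo (0:ℝ) 1} ∧
        EqOn N.integrand (fun x => 1 / (1 - x 0 * x 1 * x 2)) N.domain ∧ y = of N} ∪
      {y : FormalRep | ∃ N : IntegralRep 3, N.domain = {x | ∀ i, x i ∈ Set.Ioo (0:ℝ) 1} ∧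
        EqOn N.integrand (fun x => 1 / ((1 - x 0 * x 1) * (1 + x 2))) N.domain ∧ y = of N})
    (hN' : of N' ∈ {y : FormalRep | ∃ N : IntegralRep 3, N.domain = {x | ∀ i, x i ∈ Set.Ioo (0:ℝ) 1} ∧
        EqOn N.integrand (fun x => 1 / ((1 - x 0 * x 1) * (1 - x 0 * x 1 * x 2))) N.domain ∧ y = of N} ∪
      {y : FormalRep | ∃ N : IntegralRep 3, N.domain = {x | ∀ i, x i ∈ Set.Ioo (0:ℝ) 1} ∧
        EqOn N.integrand (fun x => 2 / (1 - x 0 * x 1 * x 2)) N.domain ∧ y = of N} ∪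
      {y : FormalRep | ∃ N : IntegralRep 3, N.domain = {x | ∀ i, x i ∈ Set.Ioo (0:ℝ) 1} ∧
        EqOn N.integrand (fun x => 8 / ((1 + x 0 * x 1) * (1 + x 0 * x 1 * x 2))) N.domain ∧ y = of N} ∪
      {y : FormalRep | ∃ N : IntegralRep 3, N.domain = {x | ∀ i, x i ∈ Set.Ioo (0:ℝ) 1} ∧
        EqOn N.integrand (fun x => 5 / (1 - x 0 * x 1 * x 2)) N.domain ∧ y = of N} ∪
      {y : FormalRep | ∃ N : IntegralRep 3, N.domain = {x | ∀ i, x i ∈ Set.Ioo (0:ℝ) 1} ∧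
        EqOn N.integrand (fun x => 16 / ((2 - x 0) * (2 - x 0 * x 1 * x 2))) N.domain ∧ y = of N} ∪
      {y : FormalRep | ∃ N : IntegralRep 3, N.domain = {x | ∀ i, x i ∈ Set.Ioo (0:ℝ) 1} ∧
        EqOn N.integrand (fun x => 2 / ((2 - x 0 * x 1) * (2 - x 0 * x 1 * x 2))) N.domain ∧ y = of N} ∪
      {y : FormalRep | ∃ N : IntegralRep 3, N.domain = {x | ∀ i, x i ∈ Set.Ioo (0:ℝ) 1} ∧
        EqOn N.integrand (fun x => 1 / ((1 + x 0) * (1 + x 0 * x 1 * x 2))) N.domain ∧ y = of N} ∪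
      {y : FormalRep | ∃ N : IntegralRep 3, N.domain = {x | ∀ i, x i ∈ Set.Ioo (0:ℝ) 1} ∧
        EqOn N.integrand (fun x => 4 / ((2 - x 0) * (1 - x 0 * x 1 * x 2))) N.domain ∧ y = of N} ∪
      {y : FormalRep | ∃ N : IntegralRep 3, N.domain = {x | ∀ i, x i ∈ Set.Ioo (0:ℝ) 1} ∧
        EqOn N.integrand (fun x => 3 / ((1 - x 0 * x 1) * (1 + x 2))) N.domain ∧ y = of N} ∪
      {y : FormalRep | ∃ N : IntegralRep 3, N.domain = {x | ∀ i, x i ∈ Set.Ioo (0:ℝ) 1} ∧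
        EqOn N.integrand (fun x => 1 / (1 - x 0 * x 1 * x 2)) N.domain ∧ y = of N} ∪
      {y : FormalRep | ∃ N : IntegralRep 3, N.domain = {x | ∀ i, x i ∈ Set.Ioo (0:ℝ) 1} ∧
        EqOn N.integrand (fun x => 1 / ((1 - x 0 * x 1) * (1 + x 2))) N.domain ∧ y = of N})
    (hv : N.value = N'.value) : Equivalent N N' :=
  m3Instances_mem_relations_of_eval_eq_zero hind
    (AddSubgroup.sub_mem _ (AddSubgroup.subset_closure hN) (AddSubgroup.subset_closure hN'))
    (by rw [map_sub, eval_of, eval_of, hv, sub_self])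

end Summit.KontsevichZagierPeriods.HurwitzMicroSectors.NormalFormPrinciple.PiBox.M3
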